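import Summits.BirchSwinnertonDyer.BirchSwinnertonDyer.Theses.ErratumRoadFive
import Summits.BirchSwinnertonDyer.BirchSwinnertonDyer.Theorems.ErratumRoadFiveJSWControlMultOfFacts
import HarnessLib

/-!
# Route `ErratumRoadFive` (rung K2): support item 19626 `JSWAnticyclotomicControlMult` BY NAME from the two Poitou–Tate facts, and from
# support item 19283 `PublishedInputsIMCReduction` ALONE (cell `bsd-stepL`, seat `bsd-stepL-imc-p1` g16;
# `--supports stmt-BirchSwinnertonDyer-19626`)

This module imports the route file (its hypotheses and conclusions ARE route decls, by name), so no `_holds` link can be stated here.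

## What this file proves

* `jswAnticyclotomicControlMult_of_poitouTate` — **`JSWAnticyclotomicControlMult`** (item 19626 = Jetchev–Skinner–Wan 2017 Thm. 3.3.1
  at a multiplicative `p`, VERBATIM) from the cited facts `poitouTate_selmerStructure_duality` and `poitouTate_sha_tateDual` ONLY, by
  `JSWControl.thm331_anticyclotomicControl_mult_of_poitouTate` (`Theorems/ErratumRoadFiveJSWControlMultOfFacts.lean`: the tree's kernel
  control theorem re-assembled on JSW's own inputs; Mazur control, Greenberg's Lemma 4.2, the torsion-robust base count under `Ш[p^∞]`
  finite, Brink Thm. 2, Milne I 2.8 and `cd_p ≤ 2` are kernel theorems).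
* `jswAnticyclotomicControlMult_of_publishedInputsIMCReduction` — **19626 ⟸ 19283**: the two facts are conjuncts 13 and 14 of the
  route's support item `PublishedInputsIMCReduction`, so the support item 19626 is implied BY NAME by a support item the route already binds.

HONEST FRAMING: theorems only (no definition, no named fact, no `sorry`); CONDITIONAL on the two cited Poitou–Tate facts (a
conditional-result for item 19626, which does NOT close); nothing about BSD is proved; no census word, tier or label moves (T7).

References: [JetchevSkinnerWan2017] Thm. 3.3.1 with Prop. 3.2.1, §3.3.3, §3.5 (3.5.c) (arXiv:1512.06894 pp. 10–15); [Castella2018] proof of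
Thm. 2.3 (arXiv:1704.06608 pp. 5–6); [MilneADT2006] I Thm. 4.10, Thm. 2.8; [Brink2007] Thm. 2.
-/

set_option autoImplicit false
-- the Theorems namespace of this sub repeats the summit name by design (D-0017 nested layout)
set_option linter.dupNamespace false

noncomputable section

open Literature.NumberTheory.EllipticCurves Literature.NumberTheory.GaloisCohomology
open Summit.BirchSwinnertonDyer.BirchSwinnertonDyer.Theses.ErratumRoadFive

namespace Summit.BirchSwinnertonDyer.BirchSwinnertonDyer.Theorems

/-- **Support item 19626 `JSWAnticyclotomicControlMult` (JSW17 Thm. 3.3.1 at a multiplicative `p`, VERBATIM) from the two Poitou–Tate facts.**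
CONDITIONAL on the cited facts BY NAME; nothing booked. [cite: JetchevSkinnerWan2017, Thm. 3.3.1 (arXiv:1512.06894 Thm. 8, p. 11) with §3.5 (3.5.c) (p. 15)]
[cite: MilneADT2006, Ch. I, Thm. 4.10 and Thm. 2.8] -/
theorem jswAnticyclotomicControlMult_of_poitouTate
    (hPT : ∀ (K : Type) [Field K] [NumberField K], poitouTate_selmerStructure_duality K)
    (hPT2 : ∀ (K : Type) [Field K] [NumberField K], poitouTate_sha_tateDual K) : JSWAnticyclotomicControlMult :=
  JSWControl.thm331_anticyclotomicControl_mult_of_poitouTate hPT hPT2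

/-- **19626 ⟸ 19283 BY NAME**: `JSWAnticyclotomicControlMult` from the route's support item `PublishedInputsIMCReduction` alone (its
conjuncts 13 `poitouTate_selmerStructure_duality` and 14 `poitouTate_sha_tateDual`). CONDITIONAL; nothing booked.
[cite: JetchevSkinnerWan2017, Thm. 3.3.1 (arXiv:1512.06894 Thm. 8, p. 11)] [cite: MilneADT2006, Ch. I, Thm. 4.10] -/
theorem jswAnticyclotomicControlMult_of_publishedInputsIMCReduction (hF : PublishedInputsIMCReduction) :
    JSWAnticyclotomicControlMult :=
  jswAnticyclotomicControlMult_of_poitouTate hF.2.2.2.2.2.2.2.2.2.2.2.2.1 hF.2.2.2.2.2.2.2.2.2.2.2.2.2.1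

end Summit.BirchSwinnertonDyer.BirchSwinnertonDyer.Theorems

end
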